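import Summits.QuantumFields.YangMills.Theorems.BalabanUVNodesK0RecordFormatNamesFluctEk
import Summits.QuantumFields.YangMills.Theorems.BalabanUVNodesK0RecordFormatNamesAx

/-!
# BalabanUVNodes — port (S1), FE brick R6∕(R-b′): PRINT's CURLY BRACKET OF (2.12) AT THE RECORD UNFOLDS INTO LEVELS — `𝐄_k` in the chart (✓`recordEkChart`, socket (o4-a)) is the Wilson term
  `(1∕g_k² − 1∕g_0²)·A^η(U_k ·)` plus the SUM OVER `j < k` OF THE LOWER-LEVEL MERGED TERMS `𝓝_{j+1}` ((0.23) p.256 ∕ (1.6) p.261) read at the PREFIX HISTORY `(g_0,…,g_j)` — i.e. of the very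
  objects ⟨27930⟩ represents at the levels `j < k` (the record's family ✓`recordTermsAx … j`); on the domains where the minimisers compose (lit `HCompT`, asserted nowhere)
  (porter hand `hand-27930-FE-1` g0, cell `ym-nodeO-ideate`; ◆ CRIT-1 g39 l.5933 (R-b′) ask ∕ ◇ lens-1 g14 `LENS-1-NODE-v20` row R6)

`--supports stmt-QuantumFields-27930` (helper; NO `--workitem`); count-neutral.  [I] = [Balaban1987RG1].

WHY.  ✓`…PortS1FEInduction.FEStepBox` hands the FE prover at level `k` the residues of `phiFE … j v′` ∕ `phiLZ … j` at all `j < k` — the representations of the merged terms `𝓝_{j+1}`.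
Print USES them through the curly bracket `{𝐄_k(U_k(e^{iB′}V^{(k)})) − 𝐄_k(U_k(V^{(k)}))}` of (2.12), because `𝐄_k = Σ_{j<k}(−β_j A^η + 𝓝_{j+1}(Ū^{j+1}U_k ·))` ((0.23)).  ◆'s (R-b′): until the
record has this unfolding BY NAME the inductive hypothesis of `FEStepBox` is «faithful to print but decorative in kernel».  The telescoping itself is lit ✓`Node00.BackgroundActionT.sum_mergedTermT_eq`
(under the located, NAMED hypothesis `HCompT` — composition of minimisers seen by the actions, [B11] Thm 1 — discharged ON DOMAINS by the closed-N09 files, never asserted); THIS FILE reads it at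
DEF-1's chart objects:
* §1 ★ `mergedTermT_extd_eq_prefix` — the level-`j` merged term at the full history `extd v` (`v ∈ ℝ^{k+1}`; for `j ≤ k` this is the genuine prefix, beyond it the clamped one) IS the one at the prefix history `prefixOf (extd v) j = (v_0,…,v_j)`
  (`A_{j+1}` reads `g_0,…,g_j` by lit ✓`effActionHT_succ` + ✓`effActionHT_congr`; the re-centred cut-off is coupling-blind, lit ✓`chiβOfRecord₁₃Ax_flowBlind`);
  `mergedTermT_eq_recordTermsAx` — and that IS the record's family ✓`recordTermsAx F a₀ ε₂₉ j (prefixOf (extd v) j) K` read at the matrix entries of the field (`readField ∘ suOfMat` undone by ✓`suOfMat_coe`).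
* §2 ★★ `recordEkChart_eq_sum_levels` — on a domain `dom ∋ V′V^{(k)}` carrying `HCompT` and with the level-`k` problem solvable at `V′V^{(k)} = pert … x`:
  `recordEkChart … B x = Σ_{j<k} recordTermsAx … j (prefixOf (extd v) j) K ⟦Ū^{j+1}(U_k(V′V^{(k)}))⟧ + (1∕(v (Fin.last k))² − 1∕(v 0)²)·A^η(U_k(V′V^{(k)}))`;
  ★★★ `recordEkBracket_eq_sum_levels` — the CURLY BRACKET = Σ_{j<k} [level-`j` merged term at `Ū^{j+1}U_k(V′V^{(k)})` − at `Ū^{j+1}U_k(V^{(k)})`] + the Wilson difference (both chart points in `dom`).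
  On the BOX (independent `g_0,…,g_k`) the Wilson coefficient is `1∕g_k² − 1∕g_0²`; along an RG run it is `−Σ_{j<k} β_j` by lit ✓`sum_beta_eq_of_rgEqH` — not needed here.
DEDUP: `extd_prefixOf_extd`, `mergedTermT_extd_eq_prefix`, `mergedTermT_eq_recordTermsAx`, `recordEkChart_eq_sum_levels`, `recordEkBracket_eq_sum_levels` — 0 tree hits (`rg -ow`); `sum_mergedTermT_eq`,
`effActionHT_congr`, `HCompT`, `recordEkChart`, `recordEkBracket`, `recordTermsAx`, `extd`, `prefixOf` IMPORTED by name.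

HONEST STATUS.  Definition chasing + one telescoping over a NAMED, UNASSERTED hypothesis (`HCompT` on a domain); NOTHING of Bałaban's (2.10)–(2.14), §3–§5 or [II] is asserted, ported or
discharged; the identification of the level-`j` arguments `Ū^{j+1}U_k(·)` with the CHARTED data `W_{B′}` of ✓`recordΦfAx … j` (what `FEStepBox`'s hypothesis literally speaks about) is NOT made
here — it is the germ-vs-domain question displayed in ✓`FEStepBox`'s docstring; `stub_FE` ∕ `stub_P0C` OPEN; ⟨27930⟩ OPEN (1∕3); NODE O 0∕1; COUNT 8∕28 · K 1∕4 UNMOVED; finite 𝕋⁴_{L^K} at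
fixed ε — NOT continuum ∕ OS ∕ Clay; **the Yang–Mills mass gap (Clay) is NOT proved by any of this.**  No `sorry`; standard axioms.

References: T. Bałaban, *Renormalization group approach to lattice gauge field theories. I*, Comm. Math. Phys. 109 (1987) 249–301 [Balaban1987RG1] — (0.22)–(0.23) p.256, (1.6) p.261,
(2.12)–(2.13) p.268, (1.1) p.260; T. Bałaban, *Averaging operations for lattice gauge theories*, Comm. Math. Phys. 98 (1985) 17–51 [Balaban1985Averaging]; [Balaban1985Variational] Thm 1 p.279.
-/

noncomputable section

open scoped BigOperators

namespace Summit.QuantumFields.YangMills.Theorems.BalabanUVNodesPortS1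

open Summit.QuantumFields.YangMills.Theorems.K0RecordFormatNames
open Literature.MathematicalPhysics.QuantumFieldTheory.Balaban1983to89
open Literature.MathematicalPhysics.QuantumFieldTheory.Balaban1983to89.Node00
open Literature.MathematicalPhysics.QuantumFieldTheory.Balaban1983to89.T4Continuum (T4Family)
open Literature.MathematicalPhysics.QuantumFieldTheory.Balaban1983to89.T4FlagMemory (extd extd_coe)

/-! ## §1  History locality of the printed sequence; the level-`j` merged term at the prefix history; the record's family -/

/-- The prefix history's clamped extension agrees with the full history's up to the prefix length: `extd (prefixOf (extd v) j) n = extd v n` for `n ≤ j`.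
[cite: Balaban1987RG1, (0.20) p.256 (bookkeeping)] -/
theorem extd_prefixOf_extd {k j : ℕ} (v : Fin (k + 1) → ℝ) {n : ℕ} (hn : n ≤ j) :
    extd (FlowStep.prefixOf (extd v) j) n = extd v n := by
  have h1 : extd (FlowStep.prefixOf (extd v) j) n = FlowStep.prefixOf (extd v) j ⟨n, Nat.lt_succ_of_le hn⟩ :=
    extd_coe (FlowStep.prefixOf (extd v) j) ⟨n, Nat.lt_succ_of_le hn⟩
  rw [h1, FlowStep.prefixOf_apply]

/-- ★ **THE LEVEL-`j` MERGED TERM AT THE FULL HISTORY IS THE ONE AT THE PREFIX HISTORY** (the re-centred (2.9) cut-off is coupling-blind; `A_{j+1}` reads `g_0,…,g_j` only): for `v ∈ ℝ^{k+1}`,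
`𝓝_{j+1}((v_0,…,v_k)˜; W) = 𝓝_{j+1}((v_0,…,v_j)˜; W)`, `˜ = extd`. [cite: Balaban1987RG1, (1.6) p.261, (0.20) p.256] -/
theorem mergedTermT_extd_eq_prefix (F : T4Family) (θ : Stage13Params F 2) (ε : ℝ) {K k : ℕ} (j : ℕ) (v : Fin (k + 1) → ℝ)
    (W : GaugeField (F.P K) (j + 1) (SU 2)) :
    mergedTermT F 2 (TβOfRecord₁₃ F 2) (chiβOfRecord₁₃Ax F 2 θ) ε K (extd v) j W =
      mergedTermT F 2 (TβOfRecord₁₃ F 2) (chiβOfRecord₁₃Ax F 2 θ) ε K (extd (FlowStep.prefixOf (extd v) j)) j W := by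
  have hg : ∀ n ≤ j, extd v n = extd (FlowStep.prefixOf (extd v) j) n :=
    fun n hn => (extd_prefixOf_extd v hn).symm
  have hχ : ∀ n ≤ j, chiβOfRecord₁₃Ax F 2 θ K (extd v) n = chiβOfRecord₁₃Ax F 2 θ K (extd (FlowStep.prefixOf (extd v) j)) n :=
    fun n _ => congrFun (chiβOfRecord₁₃Ax_flowBlind θ K (extd v) (extd (FlowStep.prefixOf (extd v) j))) n
  have hA : ∀ m ≤ j, effActionHT F 2 (TβOfRecord₁₃ F 2) (chiβOfRecord₁₃Ax F 2 θ) K (extd v) m =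
      effActionHT F 2 (TβOfRecord₁₃ F 2) (chiβOfRecord₁₃Ax F 2 θ) K (extd (FlowStep.prefixOf (extd v) j)) m :=
    effActionHT_congr (TβOfRecord₁₃ F 2) (chiβOfRecord₁₃Ax F 2 θ) hg hχ
  unfold mergedTermT
  rw [effActionHT_succ, effActionHT_succ, hA j le_rfl, hg j le_rfl, hχ j le_rfl]

/-- **The level-`j` merged term IS the record's merged-term family ✓`recordTermsAx … j` read at the matrix entries of the field** (`readField (suOfMat 2)` undone by ✓`suOfMat_coe`).
[cite: Balaban1987RG1, (1.6) p.261, (1.20) p.264 (bookkeeping)] -/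
theorem mergedTermT_eq_recordTermsAx (F : T4Family) (a₀ ε₂₉ : ℝ) {K j : ℕ} (hist : Fin (j + 1) → ℝ) (W : GaugeField (F.P K) (j + 1) (SU 2)) :
    mergedTermT F 2 (TβOfRecord₁₃ F 2) (chiβOfRecord₁₃Ax F 2 (thetaFill F a₀ ε₂₉)) (thetaFill F a₀ ε₂₉).εbg K (extd hist) j W =
      recordTermsAx F a₀ ε₂₉ j hist K (fun μ y => ((W ⟨y, μ⟩ : SU 2) : Matrix (Fin 2) (Fin 2) ℂ)) := by
  unfold recordTermsAx mergedTermFamilyMatT mergedTermFamilyT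
  congr 1
  funext b
  show W b = suOfMat 2 ((W ⟨b.src, b.dir⟩ : SU 2) : Matrix (Fin 2) (Fin 2) ℂ)
  rw [suOfMat_coe]

/-! ## §2  `𝐄_k` in the chart and the curly bracket as level sums -/

/-- ★★ **`𝐄_k` IN THE CHART AS A SUM OVER LEVELS** ((0.23) at DEF-1's chart point): on a domain `dom` where the minimisers compose as seen by the actions (lit `HCompT`, NAMED, asserted nowhere)
and the level-`k` problem is solvable at `V′V^{(k)} = pert … (portVkAx … B) x ∈ dom`,
`recordEkChart … B x = Σ_{j<k} recordTermsAx … j (v_0,…,v_j) K ⟦Ū^{j+1}(U_k(V′V^{(k)}))⟧ + (1∕v_k² − 1∕v_0²)·A^η(U_k(V′V^{(k)}))`. [cite: Balaban1987RG1, (0.22)–(0.23) p.256, (1.6) p.261, (2.12) p.268] -/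
theorem recordEkChart_eq_sum_levels (F : T4Family) (a₀ ε₂₉ : ℝ) (k : ℕ) (v : Fin (k + 1) → ℝ) (K : ℕ) (B : recordW F a₀ ε₂₉ k K) (x : FluctIdx F k K → ℝ)
    {dom : Set (GaugeField (F.P K) k (SU 2))}
    (hcomp : HCompT F 2 (TβOfRecord₁₃ F 2) (chiβOfRecord₁₃Ax F 2 (thetaFill F a₀ ε₂₉)) (thetaFill F a₀ ε₂₉).εbg K (extd v) k dom)
    (hmem : pert F k K (portVkAx F a₀ ε₂₉ k K B) x ∈ dom)
    (hk : UkExists F 2 K k (thetaFill F a₀ ε₂₉).εbg (pert F k K (portVkAx F a₀ ε₂₉ k K B) x)) :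
    recordEkChart F a₀ ε₂₉ k v K B x =
      (∑ j ∈ Finset.range k,
          recordTermsAx F a₀ ε₂₉ j (FlowStep.prefixOf (extd v) j) K
            (fun μ y => ((Averaging.iter (avOfRecord F 2 K) (j + 1)
              (Uk F 2 K k (thetaFill F a₀ ε₂₉).εbg (pert F k K (portVkAx F a₀ ε₂₉ k K B) x)) ⟨y, μ⟩ : SU 2) : Matrix (Fin 2) (Fin 2) ℂ))) +
        (1 / (v (Fin.last k)) ^ 2 - 1 / (v 0) ^ 2) *
          wilsonAction4 (Uk F 2 K k (thetaFill F a₀ ε₂₉).εbg (pert F k K (portVkAx F a₀ ε₂₉ k K B) x)) := by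
  have htel := sum_mergedTermT_eq F 2 (TβOfRecord₁₃ F 2) (chiβOfRecord₁₃Ax F 2 (thetaFill F a₀ ε₂₉)) (thetaFill F a₀ ε₂₉).εbg
    (extd v) hcomp hmem hk
  have hsum : (∑ j ∈ Finset.range k,
      recordTermsAx F a₀ ε₂₉ j (FlowStep.prefixOf (extd v) j) K
        (fun μ y => ((Averaging.iter (avOfRecord F 2 K) (j + 1)
          (Uk F 2 K k (thetaFill F a₀ ε₂₉).εbg (pert F k K (portVkAx F a₀ ε₂₉ k K B) x)) ⟨y, μ⟩ : SU 2) : Matrix (Fin 2) (Fin 2) ℂ))) =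
      ∑ j ∈ Finset.range k, mergedTermT F 2 (TβOfRecord₁₃ F 2) (chiβOfRecord₁₃Ax F 2 (thetaFill F a₀ ε₂₉)) (thetaFill F a₀ ε₂₉).εbg K (extd v) j
        (Averaging.iter (avOfRecord F 2 K) (j + 1) (Uk F 2 K k (thetaFill F a₀ ε₂₉).εbg (pert F k K (portVkAx F a₀ ε₂₉ k K B) x))) := by
    refine Finset.sum_congr rfl fun j _ => ?_
    rw [mergedTermT_extd_eq_prefix F (thetaFill F a₀ ε₂₉) _ j v, mergedTermT_eq_recordTermsAx]
  have hlast : extd v k = v (Fin.last k) := extd_coe v (Fin.last k)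
  have hzero : extd v 0 = v 0 := extd_coe v 0
  rw [hsum, htel, recordEkChart_eq]
  unfold ZeroInput.EkT
  rw [hlast, hzero]
  ring

/-- ★★★ **PRINT's CURLY BRACKET AS A SUM OVER LEVELS**: with both chart points `V′V^{(k)}` (`x`) and `V^{(k)}` (`0`) in a composing domain with solvable level-`k` problems,
`{𝐄_k(U_k(V′V^{(k)})) − 𝐄_k(U_k(V^{(k)}))} = Σ_{j<k} [𝓝_{j+1}((v_0..v_j); Ū^{j+1}U_k(V′V^{(k)})) − 𝓝_{j+1}((v_0..v_j); Ū^{j+1}U_k(V^{(k)}))] + (1∕v_k² − 1∕v_0²)·[A^η(U_k(V′V^{(k)})) − A^η(U_k(V^{(k)}))]`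
— the lower-level merged terms ARE the summands the FE step consumes. [cite: Balaban1987RG1, (2.12)–(2.13) p.268, (0.23) p.256, (1.6) p.261] -/
theorem recordEkBracket_eq_sum_levels (F : T4Family) (a₀ ε₂₉ : ℝ) (k : ℕ) (v : Fin (k + 1) → ℝ) (K : ℕ) (B : recordW F a₀ ε₂₉ k K) (x : FluctIdx F k K → ℝ)
    {dom : Set (GaugeField (F.P K) k (SU 2))}
    (hcomp : HCompT F 2 (TβOfRecord₁₃ F 2) (chiβOfRecord₁₃Ax F 2 (thetaFill F a₀ ε₂₉)) (thetaFill F a₀ ε₂₉).εbg K (extd v) k dom)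
    (hmem : pert F k K (portVkAx F a₀ ε₂₉ k K B) x ∈ dom) (hmem₀ : portVkAx F a₀ ε₂₉ k K B ∈ dom)
    (hk : UkExists F 2 K k (thetaFill F a₀ ε₂₉).εbg (pert F k K (portVkAx F a₀ ε₂₉ k K B) x))
    (hk₀ : UkExists F 2 K k (thetaFill F a₀ ε₂₉).εbg (portVkAx F a₀ ε₂₉ k K B)) :
    recordEkBracket F a₀ ε₂₉ k v K B x =
      (∑ j ∈ Finset.range k,
          (recordTermsAx F a₀ ε₂₉ j (FlowStep.prefixOf (extd v) j) K
              (fun μ y => ((Averaging.iter (avOfRecord F 2 K) (j + 1)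
                (Uk F 2 K k (thetaFill F a₀ ε₂₉).εbg (pert F k K (portVkAx F a₀ ε₂₉ k K B) x)) ⟨y, μ⟩ : SU 2) : Matrix (Fin 2) (Fin 2) ℂ)) -
            recordTermsAx F a₀ ε₂₉ j (FlowStep.prefixOf (extd v) j) K
              (fun μ y => ((Averaging.iter (avOfRecord F 2 K) (j + 1)
                (Uk F 2 K k (thetaFill F a₀ ε₂₉).εbg (portVkAx F a₀ ε₂₉ k K B)) ⟨y, μ⟩ : SU 2) : Matrix (Fin 2) (Fin 2) ℂ)))) +
        (1 / (v (Fin.last k)) ^ 2 - 1 / (v 0) ^ 2) *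
          (wilsonAction4 (Uk F 2 K k (thetaFill F a₀ ε₂₉).εbg (pert F k K (portVkAx F a₀ ε₂₉ k K B) x)) -
            wilsonAction4 (Uk F 2 K k (thetaFill F a₀ ε₂₉).εbg (portVkAx F a₀ ε₂₉ k K B))) := by
  have h0 : pert F k K (portVkAx F a₀ ε₂₉ k K B) 0 = portVkAx F a₀ ε₂₉ k K B := pert_zero F k K _
  have hx := recordEkChart_eq_sum_levels F a₀ ε₂₉ k v K B x hcomp hmem hk
  have hz := recordEkChart_eq_sum_levels F a₀ ε₂₉ k v K B 0 hcomp (by rw [h0]; exact hmem₀) (by rw [h0]; exact hk₀)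
  rw [recordEkBracket_eq, hx, hz, h0, Finset.sum_sub_distrib]
  ring

-- standard axioms only
#print axioms recordEkBracket_eq_sum_levels

end Summit.QuantumFields.YangMills.Theorems.BalabanUVNodesPortS1

end
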